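import Summits.QuantumFields.YangMills.Theorems.BalabanUVNodesPortS1JacRepresents
import Summits.QuantumFields.YangMills.Theorems.BalabanUVNodesPortS1FEStepReg
import Summits.QuantumFields.YangMills.Theorems.BalabanUVNodesPortS1JacDomTower
import Literature.MathematicalPhysics.QuantumFieldTheory.Balaban1983to89.BlockAveragingEMLProp2

/-!
# NODE O port PT-A — CLASS TWINS OF THE GERM LEMMAS (★★★ director-ym №627a (1′), g11 docket 1): at EVERY chart point `B` of print's ε₀-regular class `InRegClass F Mc k ε₀ a₀ ε₂₉ n B`
# (`U_{k+1}(W_B)` a genuine minimiser with plaquettes `< ε₀ξ²`), for ONE explicit `ε₀(L, ε₁)`, uniform in `k, n, B`: the rooted background is a (0.21) minimiser, `V^{(k)}_{ax}(W_B) =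
# axialize(Ū^k(U_{k+1}(W_B)))`, the whole averaging tower has small plaquettes, `V^{(k)}_{ax}(W_B)` is in the (0.4) guard with the letter `RecordB0BlockInvertible` and POSITIVE Jacobian
# determinants `det A₁(c) > 0`, and the Jacobian factor of `phiLZjac` IS the torus Jacobian functional of the rooted background — the `∀ᶠ B in 𝓝 0` lemmas of ✓`…PathLetter` ∕ ✓`…JacobianGerm` ∕
# ✓`…JacRepresents` with «eventually at `B = 0`» replaced by «on the class», and WITHOUT the TokP9-reg analyticity token (only TokE is read)

Cell `ym-nodeO-ideate`, porter seat PT-A-1 (gen 11); `--kind proof --supports stmt-QuantumFields-27930 --as helper`; count-neutral.  [I] = [Balaban1987RG1]; [15] = [Balaban1985Variational];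
[B7AVG] = [Balaban1985Averaging].

WHY.  v3.7's `stub_LZhalfReg : ∀ F, PortRecordLZHalfReg F` asks for the (f′) pair identity of the LZ half AT EVERY POINT of one ε₀-class (✓`…FEStepReg` §1–§2), not eventually at `B = 0`.  The germ
files derive every B-dependent input from CONTINUITY at `B = 0` (TokP9-reg); on the class the same inputs come from print's tower bounds instead: `U ∈ U_{k+1}(ε₀)` ⟹ `|∂Ū^j(U) − 1| < 2ε₀`
at every level `j ≤ k + 1` ([B7AVG] Prop. 2 (54), lit ✓`plaqSmall_iter_blockAvg_eml_eta`), hence (0.4) loops within `18L²ε₀` ([B7AVG] (19)–(20), ✓`dist1_loopHol_le`).  The ONE new ingredient is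
the positivity of the Jacobian determinants away from the germ: NOT by the intermediate value theorem along `t ↦ tB` (the class is not star-shaped) but from ▶ PTZ-1 ∕ gen-7's COMPLEX normal form
✓`norm_det_jacBlockCt_sub_le` (`|det A₁^ℂ(c)(W) − r³| ≤ r³∕2`, `r = N_c∕|I| ≥ 1∕(576L⁴)`) read at the real point `↑V` through ✓`jacBlockCt_coeField_eq_jacBlockC` + ✓`jacBlockC_coeField`.

WHAT IS PROVED (K := recordK₀ F Mc k + n for the class statements; `ε₀ ≤ 1∕(53581824·L⁶)` and `2ε₀ ≤ ε₁` where `ε₁` is the TokE radius; no analyticity hypothesis anywhere).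
* §1 `inRegClass_mono`, `inRegClass_zero` (◆ CRIT-1 g40's non-vacuity lemma: `0 ∈` the class for EVERY `ε₀ > 0`), ★ `plaqSmall_iter_of_mem_bgReg` (the tower bound at the record, all `j ≤ k+1`).
* §2 ★★ `det_b0Block_pos_of_loopSmall` — `det A₁(c)(V) > 0` at EVERY level-`k` `SU(2)` field with (0.4) loops within `α ≤ 1∕24`, `646α ≤ (576L⁴)⁻¹∕8` (no germ, no path).
* §3 at class points: `isBackground_recordBgField_of_inRegClass`, `plaqSmall_iter_recordBgField_of_inRegClass`, `plaqSmall_unitField_of_inRegClass`, ★ `portVkAx_eq_axialize_iter_of_inRegClass`,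
  `plaqSmall_portVkAx_of_inRegClass`, `loopSmall_portVkAx_of_inRegClass`, `small_portVkAx_of_inRegClass`, `smallBelow_recordBgField_of_inRegClass`, ★ `recordB0BlockInvertible_portVkAx_of_inRegClass`,
  ★★ `det_b0Block_portVkAx_pos_of_inRegClass`, ★★ `jacFactorC_portVkAx_of_inRegClass`, ★★★ `jacFactor_eq_jacTorus_of_inRegClass`.

HONEST FRAMING.  Bookkeeping over landed tower bounds and the landed complex normal form; nothing of Bałaban's RG estimates is asserted, ported or discharged here; `InRegClass` is a HYPOTHESIS
(its existence conjunct is [15] Thm 1 content, displayed); `PortRecordLZHalfReg` ∕ `P0HolExtAtRecordGL` ∕ `ClassP2Reg` ∕ `FEStepReg` inhabited NOWHERE; ⟨27930⟩ OPEN 1∕4; NODE O 0∕1; COUNT 8∕28 · K 1∕4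
UNMOVED; finite `𝕋⁴_{L^K}` at fixed ε — NOT continuum ∕ OS; **the Yang–Mills mass gap (Clay) is NOT proved by any of this.**  No `sorry`, no `def`, no `instance`; standard axioms only.
-/

noncomputable section

open scoped BigOperators Matrix.Norms.L2Operator Topology
open Filter

namespace Summit.QuantumFields.YangMills.Theorems.BalabanUVNodesPortS1

open Summit.QuantumFields.YangMills.Theorems.K0RecordFormatNames
open Literature.MathematicalPhysics.QuantumFieldTheory.Balaban1983to89
open Literature.MathematicalPhysics.QuantumFieldTheory.Balaban1983to89.Node00
open Literature.MathematicalPhysics.QuantumFieldTheory.Balaban1983to89.T4Continuum (T4Family)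
open Literature.MathematicalPhysics.QuantumFieldTheory.Balaban1983to89.BlockAveraging (Idx Small loopHol)
open Literature.MathematicalPhysics.QuantumFieldTheory.Balaban1983to89.BlockAveragingHaarAC (IsCentral nCentral nCentral_pos)
open Literature.MathematicalPhysics.QuantumFieldTheory.Balaban1983to89.ExpMeanLog (expMeanLogSU deltaSU)
open Literature.MathematicalPhysics.QuantumFieldTheory.Balaban1983to89.B15AveragingHolomorphic
open Literature.MathematicalPhysics.QuantumFieldTheory.Balaban1983to89.BlockAxialRepresentative (axialize axializer axialize_def)
open _root_.Matrix

variable (F : T4Family)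

/-! ## §1  The class: monotonicity, the base point, the tower bound -/

variable {F} in
/-- The ε₀-class grows with `ε₀`. [cite: Balaban1987RG1, (1.1)–(1.2) p.260 (bookkeeping)] -/
theorem inRegClass_mono {Mc k : ℕ} {ε₀ ε₀' a₀ ε₂₉ : ℝ} {n : ℕ} (hε : ε₀ ≤ ε₀') {B : recordW F a₀ ε₂₉ k (recordK₀ F Mc k + n)}
    (hB : InRegClass F Mc k ε₀ a₀ ε₂₉ n B) : InRegClass F Mc k ε₀' a₀ ε₂₉ n B := by
  refine ⟨hB.1, ?_⟩
  have h := hB.2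
  rw [mem_bgReg_iff] at h ⊢
  intro p
  exact (h p).trans_le (mul_le_mul_of_nonneg_right hε (sq_nonneg _))

/-- ★ **THE CLASS IS NEVER EMPTY** (◆ CRIT-1 g40's C29b non-vacuity lemma, landed at his offer): the base point `B = 0` lies in the ε₀-class for EVERY `ε₀ > 0` (`W_0 = 1`, the flat fine field is a
(0.21) minimiser over `1` within `bgReg … a₀`, and `U_{k+1}(W_0) = 1` has unit plaquettes). [cite: Balaban1987RG1, (1.1)–(1.2) p.260, (0.21) p.256; Balaban1985Variational, Thm 1 p.279] -/
theorem inRegClass_zero (Mc k n : ℕ) {ε₀ a₀ : ℝ} (ε₂₉ : ℝ) (hε₀ : 0 < ε₀) (ha₀ : 0 < a₀) :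
    letI θ := thetaFill F a₀ ε₂₉; letI := θ.instVβ₁; letI := θ.instVβ₂
    InRegClass F Mc k ε₀ a₀ ε₂₉ n (0 : recordW F a₀ ε₂₉ k (recordK₀ F Mc k + n)) := by
  letI θ := thetaFill F a₀ ε₂₉; letI := θ.instVβ₁; letI := θ.instVβ₂
  have hk := succ_le_m_add_K_recordK₀ F Mc k n
  refine ⟨?_, ?_⟩
  · rw [unitField_zero F θ k (recordK₀ F Mc k + n)]
    have hmem : (1 : GaugeField (F.P (recordK₀ F Mc k + n)) 0 (SU 2)) ∈ bgReg F 2 (recordK₀ F Mc k + n) (k + 1) θ.εbg := one_mem_bgReg _ _ ha₀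
    have h1 := BalabanUVNodes.N09FlatSectorUniqueness.isBackground_of_flat (F := F) (N := 2) (k := k + 1)
      (BalabanUVNodes.N09FlatSectorUniqueness.flat_one (P := F.P (recordK₀ F Mc k + n)) (j := 0)) hmem
    rw [B15Claim189UnitTestAtRecord.iter_avOfRecord_one F 2 (recordK₀ F Mc k + n) (k + 1)] at h1
    exact ⟨1, h1⟩
  · rw [recordBgField_zero F θ hk]
    exact one_mem_bgReg _ _ hε₀

variable {F} in
/-- ★ **THE TOWER BOUND AT THE RECORD**: a fine field of the class `U_{k+1}(ε₀)` (`|∂U − 1| < ε₀ξ²`, `ξ = L^{−(k+1)}`) has `|∂Ū^j(U) − 1| < 2ε₀` at EVERY level `j ≤ k + 1`, for `ε₀ ≤ 1∕109824` and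
`ε₀ ≤ 1∕(192L²)` — [B7AVG] Prop. 2 (52) ⇒ (54) in the torus's own units (lit ✓`plaqSmall_iter_blockAvg_eml_eta` at `α₀ := ε₀`, `η_{k+1} ≤ η_j`).
[cite: Balaban1985Averaging, Prop. 2 (54) p.26; Balaban1987RG1, (1.2) p.260, (0.18) p.255] -/
theorem plaqSmall_iter_of_mem_bgReg {K k : ℕ} {ε₀ : ℝ} (hε₀ : 0 < ε₀) (h1 : ε₀ ≤ 1 / 109824) (h2 : ε₀ ≤ 1 / (192 * (F.L : ℝ) ^ 2))
    {U : GaugeField (F.P K) 0 (SU 2)} (hU : U ∈ bgReg F 2 K (k + 1) ε₀) {j : ℕ} (hj : j ≤ k + 1) :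
    PlaqSmall (2 * ε₀) (Averaging.iter (avOfRecord F 2 K) j U) := by
  rw [mem_bgReg_iff] at hU
  have hLpos : (0 : ℝ) < F.L := by exact_mod_cast F.hL.2.le.trans_lt' (by norm_num)
  have hL1 : (1 : ℝ) ≤ F.L := by exact_mod_cast F.hL.2.le
  have hη : (F.P K).eta (k + 1) ≤ (F.P K).eta j := by
    simp only [Params.eta, T4Family.P_L]
    exact pow_le_pow_of_le_one (inv_nonneg.2 hLpos.le) (inv_le_one_of_one_le₀ hL1) hj
  have hη0 : 0 ≤ (F.P K).eta (k + 1) := by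
    simp only [Params.eta, T4Family.P_L]; positivity
  have hU' : PlaqSmall (ε₀ * (F.P K).eta j ^ 2) U := fun p =>
    (hU p).trans_le (mul_le_mul_of_nonneg_left (pow_le_pow_left₀ hη0 hη 2) hε₀.le)
  have hα3 : 143 * ((((F.P K).d + 4 : ℕ) : ℝ) ^ 2 / 4) ^ 2 * ε₀ ≤ 1 / 3 := by
    rw [T4Family.P_d]; norm_num; linarith
  have hα2 : 2 * ε₀ ≤ 2 * deltaSU (Fin 2) / ((((F.P K).d + 4) * (F.P K).L : ℕ) : ℝ) ^ 2 := by
    rw [T4Family.P_d, T4Family.P_L]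
    have h3 : (1 : ℝ) / 3 ≤ deltaSU (Fin 2) := le_min le_rfl (by rw [Fintype.card_fin]; push_cast; linarith [Real.pi_gt_three])
    have hL2 : (0 : ℝ) < (F.L : ℝ) ^ 2 := by positivity
    rw [le_div_iff₀ (by push_cast; positivity)]
    push_cast
    have : ε₀ * (192 * (F.L : ℝ) ^ 2) ≤ 1 := by rwa [le_div_iff₀ (by positivity)] at h2
    nlinarith
  exact BlockAveragingEMLProp2.plaqSmall_iter_blockAvg_eml_eta (n := Fin 2) (P := F.P K) j hε₀ hα3 hα2 hU'

/-! ## §2  ★★ Positivity of the Jacobian determinants at EVERY loop-small background (no germ, no path) -/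

/-- ★★ **`det A₁(c)(V) > 0` AT EVERY (0.4)-LOOP-SMALL LEVEL-`k` BACKGROUND**: if all (0.4) loop variables of `V` are within `α ≤ 1∕24` of `1` and `646α ≤ (576L⁴)⁻¹∕8`, then every `3 × 3`
block `A₁(c)(V)` of the δ-Jacobian has POSITIVE determinant — the complex normal form `|det A₁^ℂ(c)(↑V) − r³| ≤ r³∕2` (`r = N_c∕|I| ≥ (576L⁴)⁻¹`) read at the real point, where
`A₁^ℂ(c)(↑V) = A₁(c)(V)` entrywise. [cite: Balaban1987RG1, p.267 («h(c) … an inverse»), (0.8) p.253; Balaban1985Averaging, Prop. 3 (124) p.36; Balaban1985Variational, Prop. 9 p.309] -/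
theorem det_b0Block_pos_of_loopSmall (k K : ℕ) (hk : k + 1 ≤ (F.P K).m + (F.P K).K) (V : GaugeField (F.P K) k (SU 2)) {α : ℝ}
    (hα : ∀ (c : PBond (F.P K) (k + 1)) (i : Idx (F.P K)), dist1 (loopHol V c i) ≤ α) (hα24 : α ≤ 1 / 24)
    (hαr : 646 * α ≤ 1 / (576 * (F.L : ℝ) ^ 4) / 8) (c : PBond (F.P K) (k + 1)) :
    0 < (Matrix.of fun j j' : Fin 3 => recordLQtB0 F k K V (c, j) (c, j')).det := by
  classical
  haveI : Nonempty (Idx (F.P K)) := nonempty_idxP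
  have h3 : (1 : ℝ) / 3 ≤ deltaSU (Fin 2) := le_min le_rfl (by rw [Fintype.card_fin]; push_cast; linarith [Real.pi_gt_three])
  have hα0 : 0 ≤ α := (GaugeGroup.dist1_nonneg _).trans (hα c (Classical.arbitrary _))
  have hsmall : ∀ c' : PBond (F.P K) (k + 1), Small expMeanLogSU V c' := fun c' i =>
    lt_of_le_of_lt (hα c' i) (by rw [ExpMeanLog.expMeanLogSU_δ]; exact lt_of_lt_of_le (by linarith) h3)
  have hW : ∀ b, (coeField V b).det = 1 := fun b => (Matrix.mem_specialUnitaryGroup_iff.1 (V b).2).2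
  have hpoly : ∀ i : Idx (F.P K), ‖loopMh (coeField V) c i - 1‖ < 1 / 3 := fun i => by
    rw [loopMh_coeField]; exact ExpMeanLog.lt_third_of_lt_deltaSU (norm_loopM_coeField_sub_one_lt V c (hsmall c) i)
  have hloop : ∀ i : Idx (F.P K), ¬ IsCentral c i → ‖loopMh (coeField V) c i - 1‖ ≤ α := fun i _ => by
    rw [loopMh_coeField, ← coe_loopHol]; exact hα c i
  have hr := inv_card_le_ratio F K c
  have hαr' : 646 * α ≤ (nCentral c : ℝ) / (Fintype.card (Idx (F.P K)) : ℝ) / 8 :=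
    hαr.trans (div_le_div_of_nonneg_right hr (by norm_num))
  have hest := norm_det_jacBlockCt_sub_le hk (coeField V) hW c hpoly hα0 hα24 hloop hαr'
  rw [jacBlockCt_coeField_eq_jacBlockC V hsmall c, jacBlockC_coeField F k K hk V hsmall c] at hest
  set M : Matrix (Fin 3) (Fin 3) ℝ := Matrix.of fun j j' : Fin 3 => recordLQtB0 F k K V (c, j) (c, j') with hM
  set r : ℝ := (nCentral c : ℝ) / (Fintype.card (Idx (F.P K)) : ℝ) with hr_def
  have hr0 : 0 < r := div_pos (by exact_mod_cast nCentral_pos c) (by exact_mod_cast Fintype.card_pos)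
  have hdet : (M.map ((↑) : ℝ → ℂ)).det = ((M.det : ℝ) : ℂ) := by
    have h := RingHom.map_det Complex.ofRealHom M
    rw [RingHom.mapMatrix_apply] at h
    exact h.symm
  rw [hdet, ← Complex.ofReal_pow, ← Complex.ofReal_sub, Complex.norm_real, Real.norm_eq_abs] at hest
  have h2 := (abs_le.1 hest).1
  have hr3 : 0 < r ^ 3 := pow_pos hr0 3
  linarith

/-! ## §3  At the points of the ε₀-class -/

section Class

variable (a₀ ε₂₉ : ℝ) (Mc k n : ℕ) {ε₀ ε₁ : ℝ}

/-- **On the class the rooted background IS a (0.21) minimiser over `W_B`** (the selector's contract on the class's existence conjunct; `θ.εbg = a₀`).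
[cite: Balaban1985Variational, Thm 1 p.279; Balaban1987RG1, (0.21) p.256, (1.1) p.260] -/
theorem isBackground_recordBgField_of_inRegClass {B : recordW F a₀ ε₂₉ k (recordK₀ F Mc k + n)} (hB : InRegClass F Mc k ε₀ a₀ ε₂₉ n B) :
    letI θ := thetaFill F a₀ ε₂₉
    IsBackground (avOfRecord F 2 (recordK₀ F Mc k + n)) (bgReg F 2 (recordK₀ F Mc k + n) (k + 1) a₀) (k + 1)
      (unitField F θ k (recordK₀ F Mc k + n) B) (recordBgField F θ k (recordK₀ F Mc k + n) B) :=
  isBackground_UkSel (succ_le_m_add_K_recordK₀ F Mc k n) hB.1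

/-- **On the class the whole averaging tower of `U_{k+1}(W_B)` has small plaquettes**: `|∂Ū^j(U_{k+1}(W_B)) − 1| < 2ε₀` for every `j ≤ k + 1` (§1's tower bound).
[cite: Balaban1985Averaging, Prop. 2 (54) p.26; Balaban1987RG1, (1.2) p.260, (2.3) p.265] -/
theorem plaqSmall_iter_recordBgField_of_inRegClass (hε₀ : 0 < ε₀) (h1 : ε₀ ≤ 1 / 109824) (h2 : ε₀ ≤ 1 / (192 * (F.L : ℝ) ^ 2))
    {B : recordW F a₀ ε₂₉ k (recordK₀ F Mc k + n)} (hB : InRegClass F Mc k ε₀ a₀ ε₂₉ n B) {j : ℕ} (hj : j ≤ k + 1) :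
    letI θ := thetaFill F a₀ ε₂₉
    PlaqSmall (2 * ε₀) (Averaging.iter (avOfRecord F 2 (recordK₀ F Mc k + n)) j (recordBgField F θ k (recordK₀ F Mc k + n) B)) :=
  plaqSmall_iter_of_mem_bgReg hε₀ h1 h2 hB.2 hj

/-- **On the class the charted unit-lattice field itself has small plaquettes**: `W_B = Ū^{k+1}(U_{k+1}(W_B))` (the constraint) and §1 at `j = k + 1`.
[cite: Balaban1987RG1, (0.21) p.256, (1.2) p.260; Balaban1985Averaging, Prop. 2 (54) p.26] -/
theorem plaqSmall_unitField_of_inRegClass (hε₀ : 0 < ε₀) (h1 : ε₀ ≤ 1 / 109824) (h2 : ε₀ ≤ 1 / (192 * (F.L : ℝ) ^ 2))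
    {B : recordW F a₀ ε₂₉ k (recordK₀ F Mc k + n)} (hB : InRegClass F Mc k ε₀ a₀ ε₂₉ n B) :
    letI θ := thetaFill F a₀ ε₂₉
    PlaqSmall (2 * ε₀) (unitField F θ k (recordK₀ F Mc k + n) B) := by
  rw [← (isBackground_recordBgField_of_inRegClass F a₀ ε₂₉ Mc k n hB).1]
  exact plaqSmall_iter_recordBgField_of_inRegClass F a₀ ε₂₉ Mc k n hε₀ h1 h2 hB le_rfl

/-- ★ **ON THE CLASS `V^{(k)}_{ax}(W_B) = axialize(Ū^k(U_{k+1}(W_B)))`** — the class twin of ✓`eventually_portVkAx_eq_axialize_iter`: `W_B` has plaquettes `< 2ε₀ ≤ ε₁`, so the TokE shape gives the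
uniqueness of the minimal orbit over `W_B`, and the block-axial critical configuration is choice-free (`critCfgAxOfRecord_eq_of_isBackground`).
[cite: Balaban1987RG1, (2.2)–(2.3) p.265; Balaban1985Variational, Thm 1 p.279] -/
theorem portVkAx_eq_axialize_iter_of_inRegClass (hε₀ : 0 < ε₀) (h1 : ε₀ ≤ 1 / 109824) (h2 : ε₀ ≤ 1 / (192 * (F.L : ℝ) ^ 2)) (hε₁ : 2 * ε₀ ≤ ε₁)
    (hTokE : ∀ V : GaugeField (F.P (recordK₀ F Mc k + n)) (k + 1) (SU 2), PlaqSmall ε₁ V →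
      UkExists F 2 (recordK₀ F Mc k + n) (k + 1) a₀ V ∧ UniqueUkOrbit F 2 (recordK₀ F Mc k + n) (k + 1) a₀ V)
    {B : recordW F a₀ ε₂₉ k (recordK₀ F Mc k + n)} (hB : InRegClass F Mc k ε₀ a₀ ε₂₉ n B) :
    letI θ := thetaFill F a₀ ε₂₉
    portVkAx F a₀ ε₂₉ k (recordK₀ F Mc k + n) B =
      axialize (contourOfRecord F 2 (recordK₀ F Mc k + n) k) (Averaging.iter (avOfRecord F 2 (recordK₀ F Mc k + n)) k (recordBgField F θ k (recordK₀ F Mc k + n) B)) := by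
  have hk := succ_le_m_add_K_recordK₀ F Mc k n
  have hW : PlaqSmall ε₁ (unitField F (thetaFill F a₀ ε₂₉) k (recordK₀ F Mc k + n) B) := fun p =>
    (plaqSmall_unitField_of_inRegClass F a₀ ε₂₉ Mc k n hε₀ h1 h2 hB p).trans_le hε₁
  obtain ⟨-, huniq⟩ := hTokE _ hW
  rw [portVkAx]
  exact critCfgAxOfRecord_eq_of_isBackground (ν := (thetaFill F a₀ ε₂₉).ν) (by omega) huniq
    (isBackground_recordBgField_of_inRegClass F a₀ ε₂₉ Mc k n hB)

/-- **On the class `V^{(k)}_{ax}(W_B)` has small plaquettes** (`< 2ε₀`; `PlaqSmall` passes through `axialize`). [cite: Balaban1987RG1, (2.3) p.265, (0.18) p.255] -/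
theorem plaqSmall_portVkAx_of_inRegClass (hε₀ : 0 < ε₀) (h1 : ε₀ ≤ 1 / 109824) (h2 : ε₀ ≤ 1 / (192 * (F.L : ℝ) ^ 2)) (hε₁ : 2 * ε₀ ≤ ε₁)
    (hTokE : ∀ V : GaugeField (F.P (recordK₀ F Mc k + n)) (k + 1) (SU 2), PlaqSmall ε₁ V →
      UkExists F 2 (recordK₀ F Mc k + n) (k + 1) a₀ V ∧ UniqueUkOrbit F 2 (recordK₀ F Mc k + n) (k + 1) a₀ V)
    {B : recordW F a₀ ε₂₉ k (recordK₀ F Mc k + n)} (hB : InRegClass F Mc k ε₀ a₀ ε₂₉ n B) :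
    PlaqSmall (2 * ε₀) (portVkAx F a₀ ε₂₉ k (recordK₀ F Mc k + n) B) := by
  rw [portVkAx_eq_axialize_iter_of_inRegClass F a₀ ε₂₉ Mc k n hε₀ h1 h2 hε₁ hTokE hB,
    BalabanUVNodes.N07CritCfgAxOfRecordClauses.plaqSmall_axialize_iff]
  exact plaqSmall_iter_recordBgField_of_inRegClass F a₀ ε₂₉ Mc k n hε₀ h1 h2 hB (Nat.le_succ k)

/-- The three numeric consequences of the class radius bound `ε₀ ≤ 1∕(53581824·L⁶)` (`L ≥ 12`): `ε₀ ≤ 1∕109824`, `ε₀ ≤ 1∕(192L²)`, and for `α := 18L²ε₀`: `α ≤ 1∕24`,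
`157α < L^{−3}`, `646α ≤ (576L⁴)⁻¹∕8`. [folklore] -/
theorem classRadius_bounds {ε₀ : ℝ} (hε₀ : 0 < ε₀) (hc : ε₀ ≤ 1 / (53581824 * (F.L : ℝ) ^ 6)) :
    ε₀ ≤ 1 / 109824 ∧ ε₀ ≤ 1 / (192 * (F.L : ℝ) ^ 2) ∧ 18 * (F.L : ℝ) ^ 2 * ε₀ ≤ 1 / 24 ∧
      157 * (18 * (F.L : ℝ) ^ 2 * ε₀) < (((F.L : ℝ)) ^ 3)⁻¹ ∧ 646 * (18 * (F.L : ℝ) ^ 2 * ε₀) ≤ 1 / (576 * (F.L : ℝ) ^ 4) / 8 := by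
  have hL12 : (12 : ℝ) ≤ F.L := by exact_mod_cast F.hL11
  have hL1 : (1 : ℝ) ≤ F.L := by linarith
  have hL0 : (0 : ℝ) < F.L := by linarith
  have hL2 : (144 : ℝ) ≤ (F.L : ℝ) ^ 2 := by nlinarith
  have hL3 : (0 : ℝ) < (F.L : ℝ) ^ 3 := by positivity
  have hL4 : (0 : ℝ) < (F.L : ℝ) ^ 4 := by positivity
  have hL6 : (0 : ℝ) < (F.L : ℝ) ^ 6 := by positivity
  have hprod : ε₀ * (53581824 * (F.L : ℝ) ^ 6) ≤ 1 := by rwa [le_div_iff₀ (by positivity)] at hc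
  have e6 : (F.L : ℝ) ^ 6 = (F.L : ℝ) ^ 2 * (F.L : ℝ) ^ 4 := by ring
  have e6' : (F.L : ℝ) ^ 6 = (F.L : ℝ) ^ 3 * (F.L : ℝ) ^ 3 := by ring
  have hL4' : (1 : ℝ) ≤ (F.L : ℝ) ^ 4 := one_le_pow₀ hL1
  have hL3' : (1 : ℝ) ≤ (F.L : ℝ) ^ 3 := one_le_pow₀ hL1
  refine ⟨?_, ?_, ?_, ?_, ?_⟩
  · rw [e6] at hprod
    nlinarith [mul_nonneg hε₀.le (sub_nonneg.2 hL2), mul_nonneg hε₀.le hL4.le]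
  · rw [le_div_iff₀ (by positivity)]
    rw [e6] at hprod
    nlinarith [mul_nonneg (mul_nonneg hε₀.le (by positivity : (0 : ℝ) ≤ (F.L : ℝ) ^ 2)) (sub_nonneg.2 hL4')]
  · rw [e6] at hprod
    nlinarith [mul_nonneg (mul_nonneg hε₀.le (by positivity : (0 : ℝ) ≤ (F.L : ℝ) ^ 2)) (sub_nonneg.2 hL4')]
  · rw [lt_inv_comm₀ (by positivity) hL3, ← one_div]
    have e : (F.L : ℝ) ^ 6 = (F.L : ℝ) ^ 2 * (F.L : ℝ) ^ 3 * F.L := by ring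
    rw [e] at hprod
    have h18 : 157 * (18 * (F.L : ℝ) ^ 2 * ε₀) * (F.L : ℝ) ^ 3 ≤ 2826 / 53581824 := by
      nlinarith [mul_nonneg (mul_nonneg (mul_nonneg hε₀.le (by positivity : (0 : ℝ) ≤ (F.L : ℝ) ^ 2)) hL3.le) (sub_nonneg.2 hL1)]
    rw [lt_div_iff₀ (by positivity)]
    nlinarith
  · rw [e6] at hprod
    rw [div_div, le_div_iff₀ (by positivity)]
    nlinarith [mul_nonneg (mul_nonneg hε₀.le (by positivity : (0 : ℝ) ≤ (F.L : ℝ) ^ 2)) hL4.le]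

/-- **On the class every (0.4) loop variable of `V^{(k)}_{ax}(W_B)` is within `18L²ε₀` of `1`** (loops are products of `≤ ((d+2)L)²∕4 = 9L²` plaquettes, each within `2ε₀`).
[cite: Balaban1987RG1, (0.4) p.253, (2.3) p.265; Balaban1985Averaging, (19)–(20) p.21] -/
theorem loopSmall_portVkAx_of_inRegClass (hε₀ : 0 < ε₀) (hc : ε₀ ≤ 1 / (53581824 * (F.L : ℝ) ^ 6)) (hε₁ : 2 * ε₀ ≤ ε₁)
    (hTokE : ∀ V : GaugeField (F.P (recordK₀ F Mc k + n)) (k + 1) (SU 2), PlaqSmall ε₁ V →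
      UkExists F 2 (recordK₀ F Mc k + n) (k + 1) a₀ V ∧ UniqueUkOrbit F 2 (recordK₀ F Mc k + n) (k + 1) a₀ V)
    {B : recordW F a₀ ε₂₉ k (recordK₀ F Mc k + n)} (hB : InRegClass F Mc k ε₀ a₀ ε₂₉ n B) :
    ∀ (c : PBond (F.P (recordK₀ F Mc k + n)) (k + 1)) (i : Idx (F.P (recordK₀ F Mc k + n))),
      dist1 (loopHol (portVkAx F a₀ ε₂₉ k (recordK₀ F Mc k + n) B) c i) ≤ 18 * (F.L : ℝ) ^ 2 * ε₀ := by
  obtain ⟨h1, h2, -, -, -⟩ := classRadius_bounds F hε₀ hc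
  intro c i
  have h := LatticeWordStokes.dist1_loopHol_le (by positivity : (0 : ℝ) ≤ 2 * ε₀)
    (plaqSmall_portVkAx_of_inRegClass F a₀ ε₂₉ Mc k n hε₀ h1 h2 hε₁ hTokE hB) c i
  refine h.trans (le_of_eq ?_)
  rw [T4Family.P_d, T4Family.P_L]
  push_cast
  ring

/-- **On the class `V^{(k)}_{ax}(W_B)` is inside the (0.4) guard at every coarse bond** (`18L²ε₀ ≤ 1∕24 < δ_{SU(2)}`). [cite: Balaban1987RG1, (0.4) p.253, (2.3) p.265] -/
theorem small_portVkAx_of_inRegClass (hε₀ : 0 < ε₀) (hc : ε₀ ≤ 1 / (53581824 * (F.L : ℝ) ^ 6)) (hε₁ : 2 * ε₀ ≤ ε₁)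
    (hTokE : ∀ V : GaugeField (F.P (recordK₀ F Mc k + n)) (k + 1) (SU 2), PlaqSmall ε₁ V →
      UkExists F 2 (recordK₀ F Mc k + n) (k + 1) a₀ V ∧ UniqueUkOrbit F 2 (recordK₀ F Mc k + n) (k + 1) a₀ V)
    {B : recordW F a₀ ε₂₉ k (recordK₀ F Mc k + n)} (hB : InRegClass F Mc k ε₀ a₀ ε₂₉ n B) :
    ∀ c : PBond (F.P (recordK₀ F Mc k + n)) (k + 1), Small expMeanLogSU (portVkAx F a₀ ε₂₉ k (recordK₀ F Mc k + n) B) c := by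
  obtain ⟨-, -, h24, -, -⟩ := classRadius_bounds F hε₀ hc
  have h3 : (1 : ℝ) / 3 ≤ deltaSU (Fin 2) := le_min le_rfl (by rw [Fintype.card_fin]; push_cast; linarith [Real.pi_gt_three])
  intro c i
  refine lt_of_le_of_lt (loopSmall_portVkAx_of_inRegClass F a₀ ε₂₉ Mc k n hε₀ hc hε₁ hTokE hB c i) ?_
  rw [ExpMeanLog.expMeanLogSU_δ]
  exact lt_of_lt_of_le (by linarith) h3

/-- **On the class the rooted background is guarded below `k`**: `SmallBelow (avOfRecord …) k (U_{k+1}(W_B))` (every `Ū^j`, `j < k`, has plaquettes `< 2ε₀` and `18L²ε₀ < δ_{SU(2)}`).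
[cite: Balaban1987RG1, (0.4) p.253, (0.21) p.256, (2.3) p.265] -/
theorem smallBelow_recordBgField_of_inRegClass (hε₀ : 0 < ε₀) (hc : ε₀ ≤ 1 / (53581824 * (F.L : ℝ) ^ 6))
    {B : recordW F a₀ ε₂₉ k (recordK₀ F Mc k + n)} (hB : InRegClass F Mc k ε₀ a₀ ε₂₉ n B) :
    letI θ := thetaFill F a₀ ε₂₉
    SmallBelow (avOfRecord F 2 (recordK₀ F Mc k + n)) k (recordBgField F θ k (recordK₀ F Mc k + n) B) := by
  obtain ⟨h1, h2, h24, -, -⟩ := classRadius_bounds F hε₀ hc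
  have h3 : (1 : ℝ) / 3 ≤ deltaSU (Fin 2) := le_min le_rfl (by rw [Fintype.card_fin]; push_cast; linarith [Real.pi_gt_three])
  intro j hj c
  refine LatticeWordStokes.small_of_plaqSmall expMeanLogSU (by positivity : (0 : ℝ) ≤ 2 * ε₀)
    (plaqSmall_iter_recordBgField_of_inRegClass F a₀ ε₂₉ Mc k n hε₀ h1 h2 hB (by omega)) ?_ c
  rw [ExpMeanLog.expMeanLogSU_δ, T4Family.P_d, T4Family.P_L]
  push_cast
  have e : (6 * (F.L : ℝ)) ^ 2 / 4 * (2 * ε₀) = 18 * (F.L : ℝ) ^ 2 * ε₀ := by ring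
  rw [e]
  exact lt_of_lt_of_le (by linarith) h3

/-- ★ **THE LETTER ON THE CLASS**: `RecordB0BlockInvertible F k K (V^{(k)}_{ax}(W_B))` at every class point (✓`recordB0BlockInvertible_of_loopSmall` at `α = 18L²ε₀`).
[cite: Balaban1987RG1, p.267–268, (2.3) p.265; Balaban1985Averaging, Prop. 3 (124) p.36] -/
theorem recordB0BlockInvertible_portVkAx_of_inRegClass (hε₀ : 0 < ε₀) (hc : ε₀ ≤ 1 / (53581824 * (F.L : ℝ) ^ 6)) (hε₁ : 2 * ε₀ ≤ ε₁)
    (hTokE : ∀ V : GaugeField (F.P (recordK₀ F Mc k + n)) (k + 1) (SU 2), PlaqSmall ε₁ V →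
      UkExists F 2 (recordK₀ F Mc k + n) (k + 1) a₀ V ∧ UniqueUkOrbit F 2 (recordK₀ F Mc k + n) (k + 1) a₀ V)
    {B : recordW F a₀ ε₂₉ k (recordK₀ F Mc k + n)} (hB : InRegClass F Mc k ε₀ a₀ ε₂₉ n B) :
    RecordB0BlockInvertible F k (recordK₀ F Mc k + n) (portVkAx F a₀ ε₂₉ k (recordK₀ F Mc k + n) B) := by
  obtain ⟨-, -, h24, h157, -⟩ := classRadius_bounds F hε₀ hc
  refine recordB0BlockInvertible_of_loopSmall F k _ (succ_le_m_add_K_recordK₀ F Mc k n) _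
    (loopSmall_portVkAx_of_inRegClass F a₀ ε₂₉ Mc k n hε₀ hc hε₁ hTokE hB) h24 ?_
  rw [T4Family.P_d, T4Family.P_L]
  exact h157

open Classical in
/-- ★★ **ON THE CLASS EVERY JACOBIAN DETERMINANT `det A₁(c)(V^{(k)}_{ax}(W_B))` IS POSITIVE** — the class twin of ✓`eventually_det_b0Block_portVkAx_pos`, by §2 (no segment, no IVT).
[cite: Balaban1987RG1, p.267–268, (2.3) p.265, (0.8) p.253; Balaban1985Variational, Thm 1 p.279] -/
theorem det_b0Block_portVkAx_pos_of_inRegClass (hε₀ : 0 < ε₀) (hc : ε₀ ≤ 1 / (53581824 * (F.L : ℝ) ^ 6)) (hε₁ : 2 * ε₀ ≤ ε₁)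
    (hTokE : ∀ V : GaugeField (F.P (recordK₀ F Mc k + n)) (k + 1) (SU 2), PlaqSmall ε₁ V →
      UkExists F 2 (recordK₀ F Mc k + n) (k + 1) a₀ V ∧ UniqueUkOrbit F 2 (recordK₀ F Mc k + n) (k + 1) a₀ V)
    {B : recordW F a₀ ε₂₉ k (recordK₀ F Mc k + n)} (hB : InRegClass F Mc k ε₀ a₀ ε₂₉ n B) :
    ∀ c : PBond (F.P (recordK₀ F Mc k + n)) (k + 1),
      0 < (Matrix.of fun j j' : Fin 3 => recordLQtB0 F k (recordK₀ F Mc k + n) (portVkAx F a₀ ε₂₉ k (recordK₀ F Mc k + n) B) (c, j) (c, j')).det := by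
  obtain ⟨-, -, h24, -, h646⟩ := classRadius_bounds F hε₀ hc
  intro c
  exact det_b0Block_pos_of_loopSmall F k _ (succ_le_m_add_K_recordK₀ F Mc k n) _
    (loopSmall_portVkAx_of_inRegClass F a₀ ε₂₉ Mc k n hε₀ hc hε₁ hTokE hB) h24 h646 c

open Classical in
/-- ★★ **ROW (a) FOR `phiLZjac` ON THE CLASS, AT THE REAL POINTS** — the class twin of ✓`eventually_jacFactorC_portVkAx`: the holomorphic Jacobian factor `jacFactorC c` is ℂ-analytic at
`↑V^{(k)}_{ax}(W_B)` and its value there is `jacFactor … B c`. [cite: Balaban1987RG1, (1.18) p.263, p.268, (2.3) p.265; Balaban1985Variational, Prop. 9 p.309] -/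
theorem jacFactorC_portVkAx_of_inRegClass (hε₀ : 0 < ε₀) (hc : ε₀ ≤ 1 / (53581824 * (F.L : ℝ) ^ 6)) (hε₁ : 2 * ε₀ ≤ ε₁)
    (hTokE : ∀ V : GaugeField (F.P (recordK₀ F Mc k + n)) (k + 1) (SU 2), PlaqSmall ε₁ V →
      UkExists F 2 (recordK₀ F Mc k + n) (k + 1) a₀ V ∧ UniqueUkOrbit F 2 (recordK₀ F Mc k + n) (k + 1) a₀ V)
    {B : recordW F a₀ ε₂₉ k (recordK₀ F Mc k + n)} (hB : InRegClass F Mc k ε₀ a₀ ε₂₉ n B) :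
    ∀ c : PBond (F.P (recordK₀ F Mc k + n)) (k + 1),
      AnalyticAt ℂ (jacFactorC c : (PBond (F.P (recordK₀ F Mc k + n)) k → MatA 2) → ℂ) (coeField (portVkAx F a₀ ε₂₉ k (recordK₀ F Mc k + n) B)) ∧
        jacFactorC c (coeField (portVkAx F a₀ ε₂₉ k (recordK₀ F Mc k + n) B)) = ((jacFactor F a₀ ε₂₉ k (recordK₀ F Mc k + n) B c : ℝ) : ℂ) := by
  have hk := succ_le_m_add_K_recordK₀ F Mc k n
  have hs := small_portVkAx_of_inRegClass F a₀ ε₂₉ Mc k n hε₀ hc hε₁ hTokE hB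
  have hpos := det_b0Block_portVkAx_pos_of_inRegClass F a₀ ε₂₉ Mc k n hε₀ hc hε₁ hTokE hB
  intro c
  exact ⟨analyticAt_jacFactorC_coeField F k _ hk _ hs c (hpos c), jacFactorC_coeField F k _ hk _ hs c (hpos c)⟩

/-- ★★★ **ON THE CLASS, THE JACOBIAN FACTOR OF `phiLZjac` IS THE TORUS JACOBIAN FUNCTIONAL OF THE ROOTED BACKGROUND** — the class twin of ✓`eventually_jacFactor_eq_jacTorus`:
`↑(jacFactor … B c) = J_T(c, ↑U_{k+1}(W_B))` at every class point (the projected factor at `↑V^{(k)}_{ax}(W_B)` (guard), `V^{(k)}_{ax}(W_B) = axialize(Ū^k(U_{k+1}(W_B)))` (a gauge transform;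
invariance), `↑Ū^k = iterMh k ↑` under the guard below `k`). [cite: Balaban1987RG1, p.268, (2.3) p.265, (0.21) p.256, (1.19) p.263; Balaban1985Variational, Thm 1 p.279] -/
theorem jacFactor_eq_jacTorus_of_inRegClass (hε₀ : 0 < ε₀) (hc : ε₀ ≤ 1 / (53581824 * (F.L : ℝ) ^ 6)) (hε₁ : 2 * ε₀ ≤ ε₁)
    (hTokE : ∀ V : GaugeField (F.P (recordK₀ F Mc k + n)) (k + 1) (SU 2), PlaqSmall ε₁ V →
      UkExists F 2 (recordK₀ F Mc k + n) (k + 1) a₀ V ∧ UniqueUkOrbit F 2 (recordK₀ F Mc k + n) (k + 1) a₀ V)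
    {B : recordW F a₀ ε₂₉ k (recordK₀ F Mc k + n)} (hB : InRegClass F Mc k ε₀ a₀ ε₂₉ n B) :
    letI θ := thetaFill F a₀ ε₂₉
    ∀ c : PBond (F.P (recordK₀ F Mc k + n)) (k + 1),
      ((jacFactor F a₀ ε₂₉ k (recordK₀ F Mc k + n) B c : ℝ) : ℂ) = jacTorus k c (coeField (recordBgField F θ k (recordK₀ F Mc k + n) B)) := by
  letI θ := thetaFill F a₀ ε₂₉
  have hk := succ_le_m_add_K_recordK₀ F Mc k n
  obtain ⟨h1, h2, -, -, -⟩ := classRadius_bounds F hε₀ hc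
  have hJ := jacFactorC_portVkAx_of_inRegClass F a₀ ε₂₉ Mc k n hε₀ hc hε₁ hTokE hB
  have hs := small_portVkAx_of_inRegClass F a₀ ε₂₉ Mc k n hε₀ hc hε₁ hTokE hB
  have hax := portVkAx_eq_axialize_iter_of_inRegClass F a₀ ε₂₉ Mc k n hε₀ h1 h2 hε₁ hTokE hB
  have hsb := smallBelow_recordBgField_of_inRegClass F a₀ ε₂₉ Mc k n hε₀ hc hB
  intro c
  have hdet : ∀ x, (((axializer (contourOfRecord F 2 (recordK₀ F Mc k + n) k)
      (Averaging.iter (avOfRecord F 2 (recordK₀ F Mc k + n)) k (recordBgField F θ k (recordK₀ F Mc k + n) B)) x : SU 2) : MatA 2)).det = 1 := fun x =>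
    (Matrix.mem_specialUnitaryGroup_iff.1 (axializer (contourOfRecord F 2 (recordK₀ F Mc k + n) k)
      (Averaging.iter (avOfRecord F 2 (recordK₀ F Mc k + n)) k (recordBgField F θ k (recordK₀ F Mc k + n) B)) x).2).2
  have hco : coeField (Averaging.iter (avOfRecord F 2 (recordK₀ F Mc k + n)) k (recordBgField F θ k (recordK₀ F Mc k + n) B)) =
      iterMh k (coeField (recordBgField F θ k (recordK₀ F Mc k + n) B)) :=
    coeField_avgFamily_eq_iterMh hsb
  rw [← (hJ c).2, ← jacFactorCt_coeField_eq_jacFactorC _ hs c, hax, axialize_def, coeField_gaugeAct,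
    jacFactorCt_gauge hk (fun x => ((axializer (contourOfRecord F 2 (recordK₀ F Mc k + n) k)
      (Averaging.iter (avOfRecord F 2 (recordK₀ F Mc k + n)) k (recordBgField F θ k (recordK₀ F Mc k + n) B)) x : SU 2) : MatA 2)) hdet, hco]
  rfl

end Class

end Summit.QuantumFields.YangMills.Theorems.BalabanUVNodesPortS1

end
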